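import Summits.RiemannHypothesis.RiemannHypothesis.Theorems.WeilFormatCDataA8046Tables
import HarnessLib

/-!
# rh-explicit (venture WeilGRH): validity of the frontier rung's special-value table below mode 13 — the input of the
  Christoffel certificates at `a₀ = 4023/5000` (weil-3 gen16)

Cell `rh-explicit`, WEIL TRACK (structure seat weil-3, gen16).  Kernel certificates only (`decide +kernel`: recompute +
containment), as ONE Boolean conjunction (`checks_below_thirteen`), and ONE propositional conjunction (`inputs_valid`:
`0 < a ∧ PrimeData a ks ∧ ConstsValid (2^80) a ks C ∧ TabValid (2^80) a ks 13 tab`) — so that no declaration here repeats, even up to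
renaming, a statement of the format-C lanes' own validity files (`WeilFormatCData*TabValid*`).  Inputs: `π ∈ P`, `a ∈ A`, the constants
record, the prime data `{2, 3, 4}` (`2a = 1.6092 < log 5`) and the table slices `[0, 7)`, `[7, 13)` of `WeilFormatCDataA8046Tables.tab`
(rh-explicit-weil-grh-2).  Consumed by `ChristoffelCertificateCheck.checkCert` in `RigidityCertsA8046P*` (25-mode certificates, `N = 12`).
RH-free; no definitions; standard axioms; nothing here bears on the truth of RH.
-/

set_option linter.dupNamespace false
set_option maxRecDepth 200000
set_option autoImplicit false

namespace Summit.Ventures.WeilGRH.Christoffel.A8046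

open Literature.NumberTheory.LFunctions Literature.NumberTheory.LFunctions.Yoshida1992 Encl
  Literature.Analysis.ValidatedNumerics.NumericsMP
open Summit.RiemannHypothesis.RiemannHypothesis.Theorems.WeilFormatCData.A8046

/-- kernel: `π ∈ P`, `a ∈ A`, the constants record, the prime data (separation up to `5`), and the table slices
`[0, 7)`, `[7, 13)` — one conjunction. -/
theorem checks_below_thirteen :
    (checkPi (2 ^ 80) 70 P && checkFrac (2 ^ 80) 4023 5000 A && checkConsts prm P A ks C &&
      checkPrimeDataSep (2 ^ 80) 96 A 5 ks && checkTable prm C tab 0 7 && checkTable prm C tab 7 6) = true := by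
  decide +kernel

/-- **The inputs of the frontier certificates are valid**: `0 < a`, the prime data `{2,3,4}` is the window's, the constants record
is valid, and the special-value table is valid below mode `13`. -/
theorem inputs_valid :
    (0 : ℝ) < a ∧ PrimeData a ks ∧ ConstsValid (2 ^ 80) a ks C ∧ TabValid (2 ^ 80) a ks 13 tab := by
  have h := checks_below_thirteen
  simp only [Bool.and_eq_true] at h
  obtain ⟨⟨⟨⟨⟨hP, hA⟩, hC⟩, hK⟩, hT0⟩, hT7⟩ := h
  have ha0 : (0 : ℝ) < a := by unfold a; positivity
  have hpi : MI.mem (2 ^ 80) Real.pi P := mem_pi_of_checkPi (by norm_num) hP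
  have ha : MI.mem (2 ^ 80) a A := by unfold a; exact mem_of_checkFrac hA
  have hc : ConstsValid (2 ^ 80) a ks C :=
    constsValid_of_checkConsts (prm := prm) (by norm_num [prm]) (by norm_num [prm]) hpi ha hC
  have hk : PrimeData a ks := primeData_of_checkSep (by norm_num) ha hK
  have h7 : TabValid (2 ^ 80) a ks (0 + 7) tab :=
    (TabValid.zero (S := 2 ^ 80) (a := a) (ks := ks) (tab := tab)).extend fun n hn hnk ↦
      idxValid_of_checkTable (prm := prm) (by norm_num [prm]) ha0 hc hT0 hn hnk
  exact ⟨ha0, hk, hc, h7.extend fun n hn hnk ↦ idxValid_of_checkTable (prm := prm) (by norm_num [prm]) ha0 hc hT7 hn hnk⟩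

end Summit.Ventures.WeilGRH.Christoffel.A8046
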